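import Mathlib.LinearAlgebra.Matrix.Charpoly.Coeff
import Mathlib.LinearAlgebra.Matrix.Charpoly.Eigs
import Mathlib.LinearAlgebra.Matrix.ToLinearEquiv
import Mathlib.Analysis.Complex.Polynomial.Basic
import Mathlib.RingTheory.RootsOfUnity.Complex
import Mathlib.RingTheory.IntegralClosure.IsIntegralClosure.Basic
import Mathlib.Algebra.CharP.Lemmas
import Mathlib.Tactic.NormNum.Prime
import Mathlib.Tactic.LinearCombination
import Mathlib.Tactic.IntervalCases
import HarnessLib

/-!
# Characteristic polynomials of `3 × 3` complex matrices of finite order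

RepresentationTheory/FiniteGroups file: fully PROVED elementary theorems (no definitions, no named
facts) about a matrix `M ∈ M₃(ℂ)` of finite order, the linear-algebra input of the proof of
`psl27_degreeThree_charpoly_mod_seven` (`PSL27DegreeThreeModSevenProofs.lean`). Everything is
the standard eigenvalue bookkeeping behind a character table (eigenvalues of an element of order
`n` in a representation are `n`-th roots of unity, their product is the determinant, conjugate
elements have the same characteristic polynomial):

* `exists_charpoly_eq_prod` (`χ_M = ∏ (X - μᵢ)` over `ℂ`), `exists_eigenvector_of_isRoot`,
  `isRoot_of_eigenvector`, `root_pow_eq_one` (`Mⁿ = 1 ⇒ μᵢⁿ = 1`), `isRoot_charpoly_pow`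
  (`μ ∈ spec M ⇒ μᵏ ∈ spec Mᵏ`), `det_eq_of_charpoly_eq`;
* `eq_one_of_unipotent` — a unipotent matrix of order `2, 3` or `4` is `1`, and
  `sq_eq_one_of_charpoly`, both by explicit Bézout identities pushed through `aeval M`
  (`aeval_eq_zero_of_bezout`);
* the classifications `charpoly_of_sq_eq_one` (`M² = 1`, `det = 1`),
  `charpoly_of_pow_three_eq_one` (`M³ = 1`, `det = 1`), `charpoly_of_pow_four_eq_one`
  (`M⁴ = 1`, `det = 1`) of the possible characteristic polynomials;
* `exists_P_of_pow_seven` — if `M⁷ = 1`, `χ_M ∈ ℤ̄[X]` reduces to `(X - 1)³` under any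
  `ℤ̄ → k`, `char k = 7`; `exists_P_of_charpoly_eq_map` — integer characteristic polynomials
  lift to `ℤ̄[X]`.

## References

* [JamesLiebeck2001] G. James, M. Liebeck, *Representations and Characters of Groups*, 2nd ed.
  (2001), Ch. 9 (eigenvalues of `ρ(g)` are roots of unity), Ch. 13 (algebraic integers).
-/

noncomputable section

open Polynomial

namespace Literature.RepresentationTheory.FiniteGroups

namespace PSL27

/-! ### `3 × 3` complex matrices of finite order -/

section GL3

variable (M : Matrix (Fin 3) (Fin 3) ℂ)

/-- Over `ℂ` the characteristic polynomial of a `3 × 3` matrix factors into linear factors.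
[folklore] -/
theorem exists_charpoly_eq_prod :
    ∃ μ₁ μ₂ μ₃ : ℂ, M.charpoly = (X - C μ₁) * (X - C μ₂) * (X - C μ₃) := by
  have hs : M.charpoly.Splits := IsAlgClosed.splits _
  have hcard : M.charpoly.roots.card = 3 := by
    rw [← hs.natDegree_eq_card_roots, Matrix.charpoly_natDegree_eq_dim, Fintype.card_fin]
  obtain ⟨x, y, z, h3⟩ := Multiset.card_eq_three.1 hcard
  refine ⟨x, y, z, ?_⟩
  conv_lhs => rw [hs.eq_prod_roots_of_monic M.charpoly_monic, h3]
  simp only [Multiset.insert_eq_cons, Multiset.map_cons, Multiset.prod_cons,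
    Multiset.map_singleton, Multiset.prod_singleton]
  ring

/-- A root of the characteristic polynomial has an eigenvector. [folklore] -/
theorem exists_eigenvector_of_isRoot {μ : ℂ} (h : M.charpoly.IsRoot μ) :
    ∃ v : Fin 3 → ℂ, v ≠ 0 ∧ M.mulVec v = μ • v := by
  rw [Polynomial.IsRoot.def, Matrix.eval_charpoly] at h
  obtain ⟨v, hv, hMv⟩ := Matrix.exists_mulVec_eq_zero_iff.2 h
  refine ⟨v, hv, ?_⟩
  rw [Matrix.sub_mulVec, sub_eq_zero, Matrix.scalar_apply] at hMv
  rw [← hMv]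
  funext x
  rw [Matrix.mulVec_diagonal, Pi.smul_apply, smul_eq_mul]

/-- An eigenvalue is a root of the characteristic polynomial. [folklore] -/
theorem isRoot_of_eigenvector {μ : ℂ} {v : Fin 3 → ℂ} (hv : v ≠ 0) (h : M.mulVec v = μ • v) :
    M.charpoly.IsRoot μ := by
  rw [Polynomial.IsRoot.def, Matrix.eval_charpoly]
  refine Matrix.exists_mulVec_eq_zero_iff.1 ⟨v, hv, ?_⟩
  rw [Matrix.sub_mulVec, sub_eq_zero, Matrix.scalar_apply, h]
  funext x
  rw [Matrix.mulVec_diagonal, Pi.smul_apply, smul_eq_mul]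

/-- Eigenvectors of `M` are eigenvectors of `Mᵏ`. [folklore] -/
theorem pow_mulVec_of_eigenvector {μ : ℂ} {v : Fin 3 → ℂ} (h : M.mulVec v = μ • v) (k : ℕ) :
    (M ^ k).mulVec v = μ ^ k • v := by
  induction k with
  | zero => simp
  | succ k ih =>
    rw [pow_succ, ← Matrix.mulVec_mulVec, h, Matrix.mulVec_smul, ih, smul_smul, pow_succ']

/-- **Eigenvalues of a matrix of finite order are roots of unity**: `Mⁿ = 1` and `χ_M(μ) = 0`
imply `μⁿ = 1`. [folklore] -/
theorem root_pow_eq_one {n : ℕ} (hn : M ^ n = 1) {μ : ℂ} (h : M.charpoly.IsRoot μ) :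
    μ ^ n = 1 := by
  obtain ⟨v, hv, hMv⟩ := exists_eigenvector_of_isRoot M h
  have h1 := pow_mulVec_of_eigenvector M hMv n
  rw [hn, Matrix.one_mulVec] at h1
  have h2 : (μ ^ n - 1) • v = 0 := by rw [sub_smul, one_smul, ← h1, sub_self]
  rcases smul_eq_zero.1 h2 with h3 | h3
  · exact sub_eq_zero.1 h3
  · exact absurd h3 hv

/-- Spectral mapping (the easy inclusion): `χ_M(μ) = 0 ⇒ χ_{Mᵏ}(μᵏ) = 0`. [folklore] -/
theorem isRoot_charpoly_pow {μ : ℂ} (h : M.charpoly.IsRoot μ) (k : ℕ) :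
    (M ^ k).charpoly.IsRoot (μ ^ k) := by
  obtain ⟨v, hv, hMv⟩ := exists_eigenvector_of_isRoot M h
  exact isRoot_of_eigenvector (M ^ k) hv (pow_mulVec_of_eigenvector M hMv k)

/-- `det M` is the product of the roots of `χ_M`. [folklore] -/
theorem det_eq_of_charpoly_eq {μ₁ μ₂ μ₃ : ℂ}
    (h : M.charpoly = (X - C μ₁) * (X - C μ₂) * (X - C μ₃)) : M.det = μ₁ * μ₂ * μ₃ := by
  rw [Matrix.det_eq_sign_charpoly_coeff, h, Fintype.card_fin, Polynomial.coeff_zero_eq_eval_zero]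
  simp only [eval_mul, eval_sub, eval_X, eval_C]
  ring

/-- The displayed roots are roots. [folklore] -/
theorem isRoot_of_charpoly_eq {μ₁ μ₂ μ₃ : ℂ}
    (h : M.charpoly = (X - C μ₁) * (X - C μ₂) * (X - C μ₃)) :
    M.charpoly.IsRoot μ₁ ∧ M.charpoly.IsRoot μ₂ ∧ M.charpoly.IsRoot μ₃ := by
  refine ⟨?_, ?_, ?_⟩ <;> simp [h]

/-- Bézout transfer: if `c · r = u p + v q` in `ℂ[X]` with `c ≠ 0` and `p(M) = q(M) = 0`, then
`r(M) = 0`. [folklore] -/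
theorem aeval_eq_zero_of_bezout {p q r u v : ℂ[X]} {c : ℂ} (hc : c ≠ 0)
    (hid : C c * r = u * p + v * q) (hp : aeval M p = 0) (hq : aeval M q = 0) :
    aeval M r = 0 := by
  have h := congrArg (aeval M) hid
  rw [map_mul, Polynomial.aeval_C, Algebra.algebraMap_eq_smul_one, smul_one_mul, map_add, map_mul,
    map_mul, hp, hq, mul_zero, mul_zero, add_zero] at h
  exact (smul_eq_zero.1 h).resolve_left hc

/-- **A unipotent matrix of finite order is `1`** (orders `2, 3, 4`): `(M - 1)³ = 0` and `Mⁿ = 1`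
imply `M = 1`, by the Bézout identities `4(X-1) = (X-1)³ - (X-3)(X²-1)`,
`3(X-1) = (X+1)(X-1)³ - (X-2)(X³-1)`, `8(X-1) = (3X²+4X+3)(X-1)³ + (5-3X)(X⁴-1)`. [folklore] -/
theorem eq_one_of_unipotent {n : ℕ} (hn : n = 2 ∨ n = 3 ∨ n = 4) (h3 : (M - 1) ^ 3 = 0)
    (hM : M ^ n = 1) : M = 1 := by
  have hp : aeval M ((X - 1) ^ 3 : ℂ[X]) = 0 := by simpa using h3
  have hq : aeval M (X ^ n - 1 : ℂ[X]) = 0 := by simp [hM]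
  suffices hr : aeval M (X - 1 : ℂ[X]) = 0 by simpa [sub_eq_zero] using hr
  rcases hn with rfl | rfl | rfl
  · exact aeval_eq_zero_of_bezout M (u := 1) (v := -(X - 3)) (c := 4) (by norm_num)
      (by simp only [map_ofNat]; ring1) hp hq
  · exact aeval_eq_zero_of_bezout M (u := X + 1) (v := -(X - 2)) (c := 3) (by norm_num)
      (by simp only [map_ofNat]; ring1) hp hq
  · exact aeval_eq_zero_of_bezout M (u := 3 * X ^ 2 + 4 * X + 3) (v := 5 - 3 * X) (c := 8)
      (by norm_num) (by simp only [map_ofNat]; ring1) hp hq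

/-- `(M - 1)(M + 1)² = 0` and `M⁴ = 1` imply `M² = 1`
(`2(X² - 1) = -(X-1)·(X-1)(X+1)² + (X⁴ - 1)`). [folklore] -/
theorem sq_eq_one_of_charpoly (h3 : (M - 1) * (M + 1) ^ 2 = 0) (hM : M ^ 4 = 1) :
    M ^ 2 = 1 := by
  have hp : aeval M ((X - 1) * (X + 1) ^ 2 : ℂ[X]) = 0 := by simpa using h3
  have hq : aeval M (X ^ 4 - 1 : ℂ[X]) = 0 := by simp [hM]
  have hr := aeval_eq_zero_of_bezout M (r := X ^ 2 - 1) (u := -(X - 1)) (v := 1) (c := 2)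
    (by norm_num) (by simp only [map_ofNat]; ring1) hp hq
  simpa [sub_eq_zero] using hr

/-- `μ² = 1 ⇒ μ = ±1`. [folklore] -/
theorem eq_or_eq_neg_of_sq_eq_one {μ : ℂ} (h : μ ^ 2 = 1) : μ = 1 ∨ μ = -1 := by
  rwa [sq, mul_self_eq_one_iff] at h

/-- **Involutions**: `M² = 1` and `det M = 1` force `χ_M ∈ {(X-1)³, (X-1)(X+1)²}`. [folklore] -/
theorem charpoly_of_sq_eq_one (h2 : M ^ 2 = 1) (hdet : M.det = 1) :
    M.charpoly = (X - 1) ^ 3 ∨ M.charpoly = (X - 1) * (X + 1) ^ 2 := by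
  obtain ⟨μ₁, μ₂, μ₃, hc⟩ := exists_charpoly_eq_prod M
  obtain ⟨r1, r2, r3⟩ := isRoot_of_charpoly_eq M hc
  have hprod := det_eq_of_charpoly_eq M hc
  rw [hdet] at hprod
  rcases eq_or_eq_neg_of_sq_eq_one (root_pow_eq_one M h2 r1) with rfl | rfl <;>
  rcases eq_or_eq_neg_of_sq_eq_one (root_pow_eq_one M h2 r2) with rfl | rfl <;>
  rcases eq_or_eq_neg_of_sq_eq_one (root_pow_eq_one M h2 r3) with rfl | rfl <;>
  norm_num at hprod <;>
  simp only [map_one, map_neg, sub_neg_eq_add] at hc <;>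
  first
    | (left; rw [hc]; ring1)
    | (right; rw [hc]; ring1)

/-- **Order `3`**: `M³ = 1` and `det M = 1` force `χ_M = (X - c)³` (`c³ = 1`) or `χ_M = X³ - 1`.
[folklore] -/
theorem charpoly_of_pow_three_eq_one (h3 : M ^ 3 = 1) (hdet : M.det = 1) :
    (∃ c : ℂ, c ^ 3 = 1 ∧ M.charpoly = (X - C c) ^ 3) ∨ M.charpoly = X ^ 3 - 1 := by
  obtain ⟨μ₁, μ₂, μ₃, hc⟩ := exists_charpoly_eq_prod M
  obtain ⟨r1, r2, r3⟩ := isRoot_of_charpoly_eq M hc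
  have hω := Complex.isPrimitiveRoot_exp 3 (by norm_num)
  set ω := Complex.exp (2 * Real.pi * Complex.I / (3 : ℕ)) with hωdef
  have hω3 : ω ^ 3 = 1 := hω.pow_eq_one
  have hω1 : ω ≠ 1 := hω.ne_one (by norm_num)
  have hωq : ω ^ 2 + ω + 1 = 0 := by
    have h : (ω - 1) * (ω ^ 2 + ω + 1) = 0 := by
      have : ω ^ 3 - 1 = 0 := by rw [hω3, sub_self]
      linear_combination this
    exact (mul_eq_zero.1 h).resolve_left (sub_ne_zero.2 hω1)
  have cω3 : (C ω) ^ 3 = 1 := by rw [← map_pow, hω3, map_one]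
  have cωq : (C ω) ^ 2 + C ω + 1 = 0 := by simpa using congrArg C hωq
  obtain ⟨i, hi, rfl⟩ := hω.eq_pow_of_pow_eq_one (root_pow_eq_one M h3 r1)
  obtain ⟨j, hj, rfl⟩ := hω.eq_pow_of_pow_eq_one (root_pow_eq_one M h3 r2)
  obtain ⟨l, hl, rfl⟩ := hω.eq_pow_of_pow_eq_one (root_pow_eq_one M h3 r3)
  have hprod : 3 ∣ i + j + l := by
    rw [← hω.pow_eq_one_iff_dvd, pow_add, pow_add, ← det_eq_of_charpoly_eq M hc, hdet]
  have pc : ∀ e : ℕ, (ω ^ e) ^ 3 = 1 := fun e => by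
    rw [← pow_mul, mul_comm, pow_mul, hω3, one_pow]
  interval_cases i <;> interval_cases j <;> interval_cases l <;>
  simp only [pow_zero, pow_one, map_one, map_pow] at hc <;>
  first
    | (exfalso; omega)
    | (left; exact ⟨ω ^ 0, pc 0, by rw [hc, pow_zero, map_one]; ring1⟩)
    | (left; exact ⟨ω ^ 1, pc 1, by rw [hc, pow_one]; ring1⟩)
    | (left; exact ⟨ω ^ 2, pc 2, by rw [hc, map_pow]; ring1⟩)
    | (right; rw [hc]; linear_combination (-(X - 1) * X) * cωq + (X - 1) * cω3)

/-- **Order `4`**: `M⁴ = 1` and `det M = 1` force `χ_M ∈ {(X-1)³, (X-1)(X+1)², (X-1)(X²+1)}`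
or `χ_M = (X - s)²(X + 1)` with `s² = -1`. [folklore] -/
theorem charpoly_of_pow_four_eq_one (h4 : M ^ 4 = 1) (hdet : M.det = 1) :
    M.charpoly = (X - 1) ^ 3 ∨ M.charpoly = (X - 1) * (X + 1) ^ 2 ∨
      M.charpoly = (X - 1) * (X ^ 2 + 1) ∨
      ∃ s : ℂ, s ^ 2 = -1 ∧ M.charpoly = (X - C s) ^ 2 * (X + 1) := by
  obtain ⟨μ₁, μ₂, μ₃, hc⟩ := exists_charpoly_eq_prod M
  obtain ⟨r1, r2, r3⟩ := isRoot_of_charpoly_eq M hc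
  have hζ := Complex.isPrimitiveRoot_exp 4 (by norm_num)
  set ζ := Complex.exp (2 * Real.pi * Complex.I / (4 : ℕ)) with hζdef
  have hζ4 : ζ ^ 4 = 1 := hζ.pow_eq_one
  have hζ2 : ζ ^ 2 = -1 := by
    have hne : ζ ^ 2 ≠ 1 := hζ.pow_ne_one_of_pos_of_lt (by norm_num) (by norm_num)
    rcases eq_or_eq_neg_of_sq_eq_one (μ := ζ ^ 2) (by rw [← pow_mul]; exact hζ4) with h | h
    · exact absurd h hne
    · exact h
  have hζ3 : ζ ^ 3 = -ζ := by rw [pow_succ, hζ2]; ring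
  have cζ2 : (C ζ) ^ 2 = -1 := by rw [← map_pow, hζ2, map_neg, map_one]
  obtain ⟨i, hi, rfl⟩ := hζ.eq_pow_of_pow_eq_one (root_pow_eq_one M h4 r1)
  obtain ⟨j, hj, rfl⟩ := hζ.eq_pow_of_pow_eq_one (root_pow_eq_one M h4 r2)
  obtain ⟨l, hl, rfl⟩ := hζ.eq_pow_of_pow_eq_one (root_pow_eq_one M h4 r3)
  have hprod : 4 ∣ i + j + l := by
    rw [← hζ.pow_eq_one_iff_dvd, pow_add, pow_add, ← det_eq_of_charpoly_eq M hc, hdet]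
  interval_cases i <;> interval_cases j <;> interval_cases l <;>
  simp only [pow_zero, pow_one, hζ2, hζ3, map_one, map_neg, sub_neg_eq_add] at hc <;>
  first
    | (exfalso; omega)
    | (left; rw [hc]; ring1)
    | (right; left; rw [hc]; ring1)
    | (right; right; left; rw [hc]; linear_combination (-(X - 1)) * cζ2)
    | (right; right; right; exact ⟨ζ, hζ2, by rw [hc]; ring1⟩)
    | (right; right; right; exact ⟨-ζ, by rw [neg_sq, hζ2], by rw [hc, map_neg]; ring1⟩)

/-- **Order `7` modulo `7`**: if `M⁷ = 1` then `χ_M` has algebraic-integer coefficients and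
reduces to `(X - 1)³` under any homomorphism `ℤ̄ → k` to a ring of characteristic `7` (its roots
are `7`-th roots of unity, and `x⁷ = 1 ⇒ (x - 1)⁷ = 0` in characteristic `7`). [folklore] -/
theorem exists_P_of_pow_seven (h7 : M ^ 7 = 1) (k : Type*) [Field k] [CharP k 7]
    (red : integralClosure ℤ ℂ →+* k) :
    ∃ P : Polynomial (integralClosure ℤ ℂ),
      P.map (algebraMap (integralClosure ℤ ℂ) ℂ) = M.charpoly ∧ P.map red = (X - 1) ^ 3 := by
  obtain ⟨μ₁, μ₂, μ₃, hc⟩ := exists_charpoly_eq_prod M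
  obtain ⟨r1, r2, r3⟩ := isRoot_of_charpoly_eq M hc
  have hint : ∀ μ : ℂ, M.charpoly.IsRoot μ → μ ∈ integralClosure ℤ ℂ := fun μ hμ => by
    rw [mem_integralClosure_iff]
    exact ⟨X ^ 7 - 1, monic_X_pow_sub_C 1 (by norm_num), by simp [root_pow_eq_one M h7 hμ]⟩
  haveI : Fact (Nat.Prime 7) := ⟨by norm_num⟩
  have hred : ∀ a : integralClosure ℤ ℂ, M.charpoly.IsRoot (a : ℂ) → red a = 1 := by
    intro a ha
    have ha7 : a ^ 7 = 1 := Subtype.ext (by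
      rw [SubmonoidClass.coe_pow]; exact root_pow_eq_one M h7 ha)
    have h1 : red a ^ 7 = 1 := by rw [← map_pow, ha7, map_one]
    have h2 : (red a - 1) ^ 7 = 0 := by rw [sub_pow_char, h1, one_pow, sub_self]
    exact sub_eq_zero.1 ((pow_eq_zero_iff (by norm_num)).1 h2)
  refine ⟨(X - C ⟨μ₁, hint μ₁ r1⟩) * (X - C ⟨μ₂, hint μ₂ r2⟩) * (X - C ⟨μ₃, hint μ₃ r3⟩), ?_, ?_⟩
  · rw [hc]
    simp only [Polynomial.map_mul, Polynomial.map_sub, Polynomial.map_X, Polynomial.map_C]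
    rfl
  · simp only [Polynomial.map_mul, Polynomial.map_sub, Polynomial.map_X, Polynomial.map_C,
      hred ⟨μ₁, hint μ₁ r1⟩ r1, hred ⟨μ₂, hint μ₂ r2⟩ r2, hred ⟨μ₃, hint μ₃ r3⟩ r3, map_one]
    ring1

/-- A characteristic polynomial with integer coefficients lifts to `ℤ̄[X]` and reduces through any
`ℤ̄ → k` to the same integer polynomial. [folklore] -/
theorem exists_P_of_charpoly_eq_map (f : ℤ[X]) (hf : M.charpoly = f.map (Int.castRingHom ℂ))
    (k : Type*) [CommRing k] (red : integralClosure ℤ ℂ →+* k) :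
    ∃ P : Polynomial (integralClosure ℤ ℂ),
      P.map (algebraMap (integralClosure ℤ ℂ) ℂ) = M.charpoly ∧
        P.map red = f.map (Int.castRingHom k) := by
  refine ⟨f.map (Int.castRingHom _), ?_, ?_⟩
  · rw [hf, Polynomial.map_map, Subsingleton.elim ((algebraMap (integralClosure ℤ ℂ) ℂ).comp _)
      (Int.castRingHom ℂ)]
  · rw [Polynomial.map_map, Subsingleton.elim (red.comp _) (Int.castRingHom k)]

end GL3

end PSL27

end Literature.RepresentationTheory.FiniteGroups

end
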